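import Summits.QuantumFields.YangMills.Theorems.ColdStartUniversalityShenZhuZhuTalagrandDualLimitPointsSU2
import Summits.QuantumFields.YangMills.Theorems.ColdStartUniversalityLatticeLangevinTalagrandDual
import HarnessLib

/-!
# TALAGRAND'S TRANSPORT INEQUALITY `W₂(ν, μ_B)² ≤ (2/(1−12|β'|))·KL(ν‖μ_B)` FOR EVERY WINDOW MARGINAL `μ_B` OF EVERY INFINITE-VOLUME LIMIT POINT of
# three-dimensional `SU(2)` lattice Yang–Mills at `|β'| < 1/12` (the product Riemannian distance on `SU(2)^B`, an optimal coupling, every finite `B ⊆ E⁺(ℤ³)`)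

Seat `ym-line-csu-p1` (g43), route `ColdStartUniversality` of `Summits/QuantumFields/YangMills`, helper file (`--supports stmt-QuantumFields-24809`;
memo-g42 §3 item 3, coupling form).  `…ShenZhuZhuTalagrandDualLimitPointsSU2` proved the Bobkov–Götze dual inequality for every limit point `μ` and every
window cost `ρ_B²`.  Restricting configurations to the window, `r_B : SU(2)^(E⁺(ℤ³)) → SU(2)^B`, the marginal `μ_B = μ ∘ r_B⁻¹` is a probability measure on the
COMPACT METRIC space `(SU(2)^B, d_B)`, `d_B(u,v)² = Σ_(b∈B) ρ(u_b,v_b)²` (this file equips `SU(2)^ι`, `ι` finite, with that metric: triangle inequality, topology),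
the dual inequality descends to `μ_B` (`r_B` is surjective, so the window Hopf–Lax function is the Hopf–Lax function of `d_B` pulled back), and g42's generic
`szzWassersteinSq_le_klDiv_of_dual` (Kantorovich duality + Donsker–Varadhan) turns it into the coupling statement.
* `suProd_dist_triangle`, `suProd_distSq_eq_zero_iff`, `continuous_suProd_distSq`, ★ `isOpen_iff_suProd_ball` — `d_ι` metrises `SU(2)^ι` (`ι` finite);
* ★★ `limitPoint_window_dual` — the dual inequality for `μ_B` on `(SU(2)^B, d_B)`;
* ★★★★ **`limitPoint_window_talagrand`** — for `μ ∈ infiniteVolumeLimitPoints (fundamentalRep (Fin 2)) β'`, `|β'| < 1/12`, every finite `B` and every probability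
  `ν` on `SU(2)^B` with `KL(ν‖μ_B) < ∞`:  `szzWassersteinSq d_B² ν μ_B ≤ ofReal((2/(1−12|β'|))·KL(ν‖μ_B))` — Talagrand's `T₂` for all finite-dimensional marginals of
  every infinite-volume limit point, constant independent of the window.
THEOREMS ONLY, no definition (the metric structure is a `letI` inside the proofs), no sorry.  HONEST FRAMING: FIXED lattice, strong coupling / high temperature
`|β'| < 1/12`; a statement about limit points of the torus states, window by window (the `ρ_∞` form on `SU(2)^(E⁺(ℤ³))` is not assembled here); nothing about the
continuum; no crux, rung or summit statement is proved; the Yang–Mills mass gap is NOT proved.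
-/

set_option autoImplicit false

noncomputable section

namespace Summit.QuantumFields.YangMills.Theorems.ColdStartUniversality

open MeasureTheory Filter Topology Set Metric Finset
open scoped BigOperators NNReal ENNReal
open Literature.MathematicalPhysics.QuantumFieldTheory
open Literature.MathematicalPhysics.QuantumLattice (fundamentalRep fundamentalLatticeRep continuous_fundamentalRep fundamentalRep_apply fundamentalLatticeRep_N
  IsCylinder infiniteVolumeLimitPoints IsInfiniteVolumeLimitAlong toTorusObservable)
open InformationTheory (klDiv)

/-! ## §1. The product Riemannian distance on `SU(2)^ι`, `ι` finite -/

section ProdMetric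

variable {ι : Type*} [Fintype ι]

/-- Triangle inequality for `d_ι(u,v) = (Σ_i ρ(u_i,v_i)²)^(1/2)` (Minkowski in `ℓ²(ι)`). [folklore] -/
theorem suProd_dist_triangle (u v w : ι → Matrix.specialUnitaryGroup (Fin 2) ℂ) : (Real.sqrt (∑ i, (fundamentalLatticeRep 2).riemannDist (u i) (w i) ^ 2)) ≤ (Real.sqrt (∑ i, (fundamentalLatticeRep 2).riemannDist (u i) (v i) ^ 2)) + (Real.sqrt (∑ i, (fundamentalLatticeRep 2).riemannDist (v i) (w i) ^ 2)) := by
  classical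
  set x : EuclideanSpace ℝ ι := WithLp.toLp 2 (fun i => (fundamentalLatticeRep 2).riemannDist (u i) (v i)) with hx
  set y : EuclideanSpace ℝ ι := WithLp.toLp 2 (fun i => (fundamentalLatticeRep 2).riemannDist (v i) (w i)) with hy
  have hnx : ‖x‖ = (Real.sqrt (∑ i, (fundamentalLatticeRep 2).riemannDist (u i) (v i) ^ 2)) := by
    rw [EuclideanSpace.norm_eq]; congr 1; refine Finset.sum_congr rfl fun i _ => ?_
    rw [hx, PiLp.toLp_apply, Real.norm_eq_abs, sq_abs]
  have hny : ‖y‖ = (Real.sqrt (∑ i, (fundamentalLatticeRep 2).riemannDist (v i) (w i) ^ 2)) := by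
    rw [EuclideanSpace.norm_eq]; congr 1; refine Finset.sum_congr rfl fun i _ => ?_
    rw [hy, PiLp.toLp_apply, Real.norm_eq_abs, sq_abs]
  have hnxy : (Real.sqrt (∑ i, (fundamentalLatticeRep 2).riemannDist (u i) (w i) ^ 2)) ≤ ‖x + y‖ := by
    rw [EuclideanSpace.norm_eq]
    refine Real.sqrt_le_sqrt (Finset.sum_le_sum fun i _ => ?_)
    rw [Real.norm_eq_abs, sq_abs]
    have h0 := (fundamentalLatticeRep 2).riemannDist_nonneg (u i) (w i)
    have htri := riemannDist_two_triangle (u i) (v i) (w i)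
    have hsum : (x + y) i = (fundamentalLatticeRep 2).riemannDist (u i) (v i) + (fundamentalLatticeRep 2).riemannDist (v i) (w i) := by rw [hx, hy]; rfl
    rw [hsum]
    exact pow_le_pow_left₀ h0 htri 2
  calc (Real.sqrt (∑ i, (fundamentalLatticeRep 2).riemannDist (u i) (w i) ^ 2)) ≤ ‖x + y‖ := hnxy
    _ ≤ ‖x‖ + ‖y‖ := norm_add_le x y
    _ = _ := by rw [hnx, hny]

/-- `d_ι(u,v) = 0 ↔ u = v`. [folklore] -/
theorem suProd_distSq_eq_zero_iff (u v : ι → Matrix.specialUnitaryGroup (Fin 2) ℂ) : (∑ i, (fundamentalLatticeRep 2).riemannDist (u i) (v i) ^ 2) = 0 ↔ u = v := by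
  rw [Finset.sum_eq_zero_iff_of_nonneg (fun i _ => sq_nonneg _)]
  constructor
  · intro h; funext i
    have hi := h i (Finset.mem_univ i)
    rw [sq_eq_zero_iff, riemannDist_two_eq_zero_iff] at hi
    exact hi
  · intro h i _
    rw [h, (fundamentalLatticeRep 2).riemannDist_self, sq, mul_zero]

/-- `(u,v) ↦ d_ι(u,v)²` is continuous for the product topology. [folklore] -/
theorem continuous_suProd_distSq : Continuous fun p : (ι → Matrix.specialUnitaryGroup (Fin 2) ℂ) × (ι → Matrix.specialUnitaryGroup (Fin 2) ℂ) => (∑ i, (fundamentalLatticeRep 2).riemannDist (p.1 i) (p.2 i) ^ 2) := by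
  refine continuous_finsetSum _ fun i _ => ?_
  have hi : Continuous fun p : (ι → Matrix.specialUnitaryGroup (Fin 2) ℂ) × (ι → Matrix.specialUnitaryGroup (Fin 2) ℂ) => ((p.1 i, p.2 i) : Matrix.specialUnitaryGroup (Fin 2) ℂ × Matrix.specialUnitaryGroup (Fin 2) ℂ) :=
    ((continuous_apply i).comp continuous_fst).prodMk ((continuous_apply i).comp continuous_snd)
  exact (continuous_riemannDist_two.comp hi).pow 2

/-- ★ **`d_ι` generates the product topology of `SU(2)^ι`** (compactness and continuity of `d_ι`). [folklore] -/
theorem isOpen_iff_suProd_ball (s : Set (ι → Matrix.specialUnitaryGroup (Fin 2) ℂ)) :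
    IsOpen s ↔ ∀ x ∈ s, ∃ ε > 0, ∀ y : ι → Matrix.specialUnitaryGroup (Fin 2) ℂ, (Real.sqrt (∑ i, (fundamentalLatticeRep 2).riemannDist (x i) (y i) ^ 2)) < ε → y ∈ s := by
  have hcx : ∀ x : ι → Matrix.specialUnitaryGroup (Fin 2) ℂ, Continuous fun y : ι → Matrix.specialUnitaryGroup (Fin 2) ℂ => (Real.sqrt (∑ i, (fundamentalLatticeRep 2).riemannDist (x i) (y i) ^ 2)) := fun x =>
    Real.continuous_sqrt.comp (continuous_finsetSum _ fun i _ => ((continuous_riemannDist_two_right (x i)).comp (continuous_apply i)).pow 2)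
  constructor
  · intro hs x hx
    by_contra h
    push Not at h
    have hch : ∀ n : ℕ, ∃ y : ι → Matrix.specialUnitaryGroup (Fin 2) ℂ, (Real.sqrt (∑ i, (fundamentalLatticeRep 2).riemannDist (x i) (y i) ^ 2)) < 1 / ((n : ℝ) + 1) ∧ y ∉ s :=
      fun n => h (1 / ((n : ℝ) + 1)) (by positivity)
    choose y hy using hch
    -- a convergent subsequence
    obtain ⟨z, -, φ, hφ, hlim⟩ := (isCompact_univ (X := ι → Matrix.specialUnitaryGroup (Fin 2) ℂ)).tendsto_subseq (x := y) fun n => Set.mem_univ _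
    -- its limit is `x`
    have hdz : (Real.sqrt (∑ i, (fundamentalLatticeRep 2).riemannDist (x i) (z i) ^ 2)) = 0 := by
      have h1 : Tendsto (fun n => (Real.sqrt (∑ i, (fundamentalLatticeRep 2).riemannDist (x i) (y (φ n) i) ^ 2))) atTop (𝓝 (Real.sqrt (∑ i, (fundamentalLatticeRep 2).riemannDist (x i) (z i) ^ 2))) := ((hcx x).tendsto z).comp hlim
      have h2 : Tendsto (fun n => (Real.sqrt (∑ i, (fundamentalLatticeRep 2).riemannDist (x i) (y (φ n) i) ^ 2))) atTop (𝓝 0) := by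
        have h0 : Tendsto (fun n : ℕ => 1 / ((n : ℝ) + 1)) atTop (𝓝 0) := tendsto_one_div_add_atTop_nhds_zero_nat
        have h0' : Tendsto (fun n : ℕ => 1 / (((φ n : ℕ) : ℝ) + 1)) atTop (𝓝 0) := h0.comp hφ.tendsto_atTop
        exact squeeze_zero (fun n => Real.sqrt_nonneg _) (fun n => (hy (φ n)).1.le) h0'
      exact tendsto_nhds_unique h1 h2
    have hzx : z = x := by
      have h0 : 0 ≤ (∑ i, (fundamentalLatticeRep 2).riemannDist (x i) (z i) ^ 2) := Finset.sum_nonneg fun _ _ => sq_nonneg _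
      rw [Real.sqrt_eq_zero h0, suProd_distSq_eq_zero_iff] at hdz
      exact hdz.symm
    rw [hzx] at hlim
    obtain ⟨n, hn⟩ := (hlim.eventually (hs.mem_nhds hx)).exists
    exact (hy (φ n)).2 hn
  · intro h
    rw [isOpen_iff_mem_nhds]
    intro x hx
    obtain ⟨ε, hε, hball⟩ := h x hx
    have hopen : IsOpen {y : ι → Matrix.specialUnitaryGroup (Fin 2) ℂ | (Real.sqrt (∑ i, (fundamentalLatticeRep 2).riemannDist (x i) (y i) ^ 2)) < ε} := isOpen_lt (hcx x) continuous_const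
    have hxB : x ∈ {y : ι → Matrix.specialUnitaryGroup (Fin 2) ℂ | (Real.sqrt (∑ i, (fundamentalLatticeRep 2).riemannDist (x i) (y i) ^ 2)) < ε} := by
      simp only [Set.mem_setOf_eq, (suProd_distSq_eq_zero_iff x x).2 rfl, Real.sqrt_zero]; exact hε
    exact Filter.mem_of_superset (hopen.mem_nhds hxB) fun y hy => hball y hy

end ProdMetric

/-! ## §2. The dual inequality for the window marginals -/

/-- ★★ **Dual `T₂` for the window marginal.**  For `μ ∈ infiniteVolumeLimitPoints (fundamentalRep (Fin 2)) β'`, `|β'| < 1/12`, a finite window `B` and the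
restriction `r_B x = x|_B`: for every `d_B`-Lipschitz `f : SU(2)^B → ℝ`,
`∫ exp(inf_v [f v + d_B(r_B x, v)²/(2C)]) dμ(x) ≤ exp(∫ f∘r_B dμ)`, `C = 1/(1−12|β'|)` (the window Hopf–Lax function of `f∘r_B` is this integrand, `r_B` onto).
[cite: BakryGentilLedoux2014, Thm 9.6.1] -/
theorem limitPoint_window_dual {β' : ℝ} (hβ : |β'| < 1 / 12) {μ : Measure (Literature.MathematicalPhysics.QuantumLattice.LGConfig 3 (Matrix.specialUnitaryGroup (Fin 2) ℂ))}
    (hμ : μ ∈ infiniteVolumeLimitPoints (d := 3) (fundamentalRep (Fin 2)) β') (B : Finset (Literature.MathematicalPhysics.QuantumLattice.ZdEdge 3))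
    {f : (↥B → Matrix.specialUnitaryGroup (Fin 2) ℂ) → ℝ} {Lf : ℝ} (hLf : 0 ≤ Lf) (hlip : ∀ u v : (↥B → Matrix.specialUnitaryGroup (Fin 2) ℂ), |f v - f u| ≤ Lf * (Real.sqrt (∑ i, (fundamentalLatticeRep 2).riemannDist (u i) (v i) ^ 2))) :
    ∫ x, Real.exp (⨅ v : (↥B → Matrix.specialUnitaryGroup (Fin 2) ℂ), (f v + (∑ i, (fundamentalLatticeRep 2).riemannDist ((fun (x : Literature.MathematicalPhysics.QuantumLattice.LGConfig 3 (Matrix.specialUnitaryGroup (Fin 2) ℂ)) (b : ↥B) => x b.1) x i) (v i) ^ 2) / (2 * (1 / (1 - 12 * |β'|))))) ∂μ ≤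
      Real.exp (∫ x, f ((fun (x : Literature.MathematicalPhysics.QuantumLattice.LGConfig 3 (Matrix.specialUnitaryGroup (Fin 2) ℂ)) (b : ↥B) => x b.1) x) ∂μ) := by
  classical
  have hsurj : Function.Surjective (fun (x : Literature.MathematicalPhysics.QuantumLattice.LGConfig 3 (Matrix.specialUnitaryGroup (Fin 2) ℂ)) (b : ↥B) => x b.1) := by
    intro v
    refine ⟨fun et => if h : et ∈ B then v ⟨et, h⟩ else 1, funext fun b => ?_⟩
    simp [b.2]
  -- the window Hopf–Lax function of `f∘r_B`
  have hsum : ∀ x y : Literature.MathematicalPhysics.QuantumLattice.LGConfig 3 (Matrix.specialUnitaryGroup (Fin 2) ℂ), (∑ i, (fundamentalLatticeRep 2).riemannDist ((fun (x : Literature.MathematicalPhysics.QuantumLattice.LGConfig 3 (Matrix.specialUnitaryGroup (Fin 2) ℂ)) (b : ↥B) => x b.1) x i) ((fun (x : Literature.MathematicalPhysics.QuantumLattice.LGConfig 3 (Matrix.specialUnitaryGroup (Fin 2) ℂ)) (b : ↥B) => x b.1) y i) ^ 2) = (∑ et ∈ B, (fundamentalLatticeRep 2).riemannDist (x et) (y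 et) ^ 2) := fun x y =>
    Finset.sum_coe_sort B (fun et => (fundamentalLatticeRep 2).riemannDist (x et) (y et) ^ 2)
  have hlipφ : ∀ x y : Literature.MathematicalPhysics.QuantumLattice.LGConfig 3 (Matrix.specialUnitaryGroup (Fin 2) ℂ), |f ((fun (x : Literature.MathematicalPhysics.QuantumLattice.LGConfig 3 (Matrix.specialUnitaryGroup (Fin 2) ℂ)) (b : ↥B) => x b.1) y) - f ((fun (x : Literature.MathematicalPhysics.QuantumLattice.LGConfig 3 (Matrix.specialUnitaryGroup (Fin 2) ℂ)) (b : ↥B) => x b.1) x)| ≤ Lf * Real.sqrt (∑ et ∈ B, (fundamentalLatticeRep 2).riemannDist (x et) (y et) ^ 2) := fun x y => by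
    rw [← hsum x y]; exact hlip _ _
  have hmain := limitPoint_integral_exp_hopfLaxWindow_le hβ hμ B hLf hlipφ
  have heq : ∀ x : Literature.MathematicalPhysics.QuantumLattice.LGConfig 3 (Matrix.specialUnitaryGroup (Fin 2) ℂ), (⨅ v : (↥B → Matrix.specialUnitaryGroup (Fin 2) ℂ), (f v + (∑ i, (fundamentalLatticeRep 2).riemannDist ((fun (x : Literature.MathematicalPhysics.QuantumLattice.LGConfig 3 (Matrix.specialUnitaryGroup (Fin 2) ℂ)) (b : ↥B) => x b.1) x i) (v i) ^ 2) / (2 * (1 / (1 - 12 * |β'|))))) =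
      ⨅ y : Literature.MathematicalPhysics.QuantumLattice.LGConfig 3 (Matrix.specialUnitaryGroup (Fin 2) ℂ), (f ((fun (x : Literature.MathematicalPhysics.QuantumLattice.LGConfig 3 (Matrix.specialUnitaryGroup (Fin 2) ℂ)) (b : ↥B) => x b.1) y) + (∑ et ∈ B, (fundamentalLatticeRep 2).riemannDist (x et) (y et) ^ 2) / (2 * (1 / (1 - 12 * |β'|)))) := by
    intro x
    rw [← hsurj.iInf_comp (fun v : (↥B → Matrix.specialUnitaryGroup (Fin 2) ℂ) => f v + (∑ i, (fundamentalLatticeRep 2).riemannDist ((fun (x : Literature.MathematicalPhysics.QuantumLattice.LGConfig 3 (Matrix.specialUnitaryGroup (Fin 2) ℂ)) (b : ↥B) => x b.1) x i) (v i) ^ 2) / (2 * (1 / (1 - 12 * |β'|))))]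
    exact congrArg iInf (funext fun y => by rw [hsum x y])
  simp_rw [heq]
  exact hmain

/-! ## §3. Talagrand's inequality for the window marginals -/

/-- ★★★★ **Talagrand's `T₂(1/(1−12|β'|))` for every finite-dimensional marginal of every infinite-volume limit point.**  Let `|β'| < 1/12`, let `μ` be an
infinite-volume limit point of the torus Wilson states of three-dimensional `SU(2)` lattice Yang–Mills at coupling `β'`, let `B ⊆ E⁺(ℤ³)` be finite and
`μ_B = μ ∘ r_B⁻¹` its window marginal on `SU(2)^B`.  Then for every probability measure `ν` on `SU(2)^B` with `KL(ν‖μ_B) < ∞`: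
`szzWassersteinSq d_B² ν μ_B ≤ ofReal((2/(1−12|β'|))·KL(ν‖μ_B))` — an OPTIMAL COUPLING `π` of `ν` and `μ_B` with `∫ d_B² dπ ≤ (2/(1−12|β'|))·KL(ν‖μ_B)`,
`d_B(u,v)² = Σ_(b∈B) ρ(u_b,v_b)²`, with a constant that does not depend on the window. [cite: BakryGentilLedoux2014, Thm 9.6.1] [cite: ShenZhuZhuCMP2023, Theorem 1.4] -/
theorem limitPoint_window_talagrand {β' : ℝ} (hβ : |β'| < 1 / 12) {μ : Measure (Literature.MathematicalPhysics.QuantumLattice.LGConfig 3 (Matrix.specialUnitaryGroup (Fin 2) ℂ))}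
    (hμ : μ ∈ infiniteVolumeLimitPoints (d := 3) (fundamentalRep (Fin 2)) β') (B : Finset (Literature.MathematicalPhysics.QuantumLattice.ZdEdge 3))
    (ν : Measure (↥B → Matrix.specialUnitaryGroup (Fin 2) ℂ)) [IsProbabilityMeasure ν] (hfin : klDiv ν (μ.map (fun (x : Literature.MathematicalPhysics.QuantumLattice.LGConfig 3 (Matrix.specialUnitaryGroup (Fin 2) ℂ)) (b : ↥B) => x b.1)) ≠ ∞) :
    szzWassersteinSq (fun u v : (↥B → Matrix.specialUnitaryGroup (Fin 2) ℂ) => (∑ i, (fundamentalLatticeRep 2).riemannDist (u i) (v i) ^ 2)) ν (μ.map (fun (x : Literature.MathematicalPhysics.QuantumLattice.LGConfig 3 (Matrix.specialUnitaryGroup (Fin 2) ℂ)) (b : ↥B) => x b.1)) ≤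
      ENNReal.ofReal (2 * (1 / (1 - 12 * |β'|)) * (klDiv ν (μ.map (fun (x : Literature.MathematicalPhysics.QuantumLattice.LGConfig 3 (Matrix.specialUnitaryGroup (Fin 2) ℂ)) (b : ↥B) => x b.1))).toReal) := by
  classical
  haveI := secondCountableTopology_su2
  obtain ⟨Ls, hLs, hprob, hlim⟩ := hμ
  haveI := hprob
  have hμ' : μ ∈ infiniteVolumeLimitPoints (d := 3) (fundamentalRep (Fin 2)) β' := ⟨Ls, hLs, hprob, hlim⟩
  have h12 : 0 < 1 - 12 * |β'| := by linarith
  have hC : 0 < (1 / (1 - 12 * |β'|)) := by positivity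
  -- `SU(2)^B` as a compact metric space for `d_B`
  have hnn : ∀ u v : (↥B → Matrix.specialUnitaryGroup (Fin 2) ℂ), 0 ≤ (∑ i, (fundamentalLatticeRep 2).riemannDist (u i) (v i) ^ 2) := fun u v => Finset.sum_nonneg fun _ _ => sq_nonneg _
  have hzero : ∀ u v : (↥B → Matrix.specialUnitaryGroup (Fin 2) ℂ), (Real.sqrt (∑ i, (fundamentalLatticeRep 2).riemannDist (u i) (v i) ^ 2)) = 0 ↔ u = v := fun u v => by rw [Real.sqrt_eq_zero (hnn u v), suProd_distSq_eq_zero_iff]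
  have hself : ∀ u : (↥B → Matrix.specialUnitaryGroup (Fin 2) ℂ), (Real.sqrt (∑ i, (fundamentalLatticeRep 2).riemannDist (u i) (u i) ^ 2)) = 0 := fun u => (hzero u u).2 rfl
  have hcomm : ∀ u v : (↥B → Matrix.specialUnitaryGroup (Fin 2) ℂ), (Real.sqrt (∑ i, (fundamentalLatticeRep 2).riemannDist (u i) (v i) ^ 2)) = (Real.sqrt (∑ i, (fundamentalLatticeRep 2).riemannDist (v i) (u i) ^ 2)) := fun u v => by
    congr 1; exact Finset.sum_congr rfl fun i _ => by rw [riemannDist_two_comm]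
  letI : MetricSpace (↥B → Matrix.specialUnitaryGroup (Fin 2) ℂ) :=
    { __ := PseudoMetricSpace.ofDistTopology (fun u v : (↥B → Matrix.specialUnitaryGroup (Fin 2) ℂ) => (Real.sqrt (∑ i, (fundamentalLatticeRep 2).riemannDist (u i) (v i) ^ 2))) hself hcomm suProd_dist_triangle isOpen_iff_suProd_ball,
      eq_of_dist_eq_zero := fun {u v} huv => (hzero u v).1 huv }
  haveI : BorelSpace (↥B → Matrix.specialUnitaryGroup (Fin 2) ℂ) := Pi.borelSpace
  have hdist : ∀ u v : (↥B → Matrix.specialUnitaryGroup (Fin 2) ℂ), dist u v = (Real.sqrt (∑ i, (fundamentalLatticeRep 2).riemannDist (u i) (v i) ^ 2)) := fun u v => rfl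
  have hr : Measurable (fun (x : Literature.MathematicalPhysics.QuantumLattice.LGConfig 3 (Matrix.specialUnitaryGroup (Fin 2) ℂ)) (b : ↥B) => x b.1) := measurable_pi_lambda _ fun b => measurable_pi_apply _
  have hrc : Continuous (fun (x : Literature.MathematicalPhysics.QuantumLattice.LGConfig 3 (Matrix.specialUnitaryGroup (Fin 2) ℂ)) (b : ↥B) => x b.1) := continuous_pi fun b => continuous_apply _
  haveI : IsProbabilityMeasure (μ.map (fun (x : Literature.MathematicalPhysics.QuantumLattice.LGConfig 3 (Matrix.specialUnitaryGroup (Fin 2) ℂ)) (b : ↥B) => x b.1)) := Measure.isProbabilityMeasure_map hr.aemeasurable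
  -- the dual inequality on the marginal
  have hdual : ∀ (f : (↥B → Matrix.specialUnitaryGroup (Fin 2) ℂ) → ℝ) (Lf : ℝ), Continuous f → 0 ≤ Lf → (∀ z w, |f z - f w| ≤ Lf * dist z w) →
      ∫ u, Real.exp (⨅ v, (f v + dist u v ^ 2 / (2 * (1 / (1 - 12 * |β'|))))) ∂(μ.map (fun (x : Literature.MathematicalPhysics.QuantumLattice.LGConfig 3 (Matrix.specialUnitaryGroup (Fin 2) ℂ)) (b : ↥B) => x b.1)) ≤ Real.exp (∫ u, f u ∂(μ.map (fun (x : Literature.MathematicalPhysics.QuantumLattice.LGConfig 3 (Matrix.specialUnitaryGroup (Fin 2) ℂ)) (b : ↥B) => x b.1))) := by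
    intro f Lf hf hLf hlipf
    have hlip' : ∀ u v : (↥B → Matrix.specialUnitaryGroup (Fin 2) ℂ), |f v - f u| ≤ Lf * (Real.sqrt (∑ i, (fundamentalLatticeRep 2).riemannDist (u i) (v i) ^ 2)) := fun u v => by rw [← hdist, dist_comm]; exact hlipf v u
    have hQc : Continuous fun u : (↥B → Matrix.specialUnitaryGroup (Fin 2) ℂ) => ⨅ v, (f v + dist u v ^ 2 / (2 * (1 / (1 - 12 * |β'|)))) := hopfLax_continuous hf hLf hlipf (by positivity)
    rw [integral_map hr.aemeasurable hQc.rexp.aestronglyMeasurable, integral_map hr.aemeasurable hf.aestronglyMeasurable]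
    have h := limitPoint_window_dual hβ hμ' B hLf hlip'
    refine le_of_eq_of_le ?_ h
    refine integral_congr_ae (ae_of_all _ fun x => ?_)
    show Real.exp (⨅ v, (f v + dist ((fun (x : Literature.MathematicalPhysics.QuantumLattice.LGConfig 3 (Matrix.specialUnitaryGroup (Fin 2) ℂ)) (b : ↥B) => x b.1) x) v ^ 2 / (2 * (1 / (1 - 12 * |β'|))))) = _
    congr 1
    exact congrArg iInf (funext fun v => by rw [hdist, Real.sq_sqrt (hnn _ _)])
  have hT := szzWassersteinSq_le_klDiv_of_dual (μ.map (fun (x : Literature.MathematicalPhysics.QuantumLattice.LGConfig 3 (Matrix.specialUnitaryGroup (Fin 2) ℂ)) (b : ↥B) => x b.1)) hC hdual ν hfin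
  have hcost : (fun u v : (↥B → Matrix.specialUnitaryGroup (Fin 2) ℂ) => dist u v ^ 2) = fun u v : (↥B → Matrix.specialUnitaryGroup (Fin 2) ℂ) => (∑ i, (fundamentalLatticeRep 2).riemannDist (u i) (v i) ^ 2) := by
    funext u v; rw [hdist, Real.sq_sqrt (hnn u v)]
  rw [hcost] at hT
  exact hT

end Summit.QuantumFields.YangMills.Theorems.ColdStartUniversality
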